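import Summits.KontsevichZagierPeriods.Zeta5Search.WedgeDictionaryLevelDescentVFullDescentLemmas
import HarnessLib

/-!
# Level descent for `VFull` — slot-1 DESCENT: (T3) from two identities of the boundary sum alone

HONEST FRAMING: "systematic search; no irrationality claim unless certified".

(T3) = `ldSE_rowSource_stmt` (the last open input of `levelDescentVFull`; `levelDescentVFull_reduction_holds`) reads, with
`Y(b) := (d+1)·SE(b) − Π₂(b)·SE(b − e₂)` (`ldY`) and `T(b) := Y(b) − η(b − e₂)·U(b)` (`ldT`): `T(b) = 0` on the rows
`b₇ = 0`, `b₂ ≥ 1`, `b₁ + b₂ ≤ N` (`B`-slots in the half box, `d ≥ 0`). This file proves, with no `sorry`, the REDUCTION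

  `ldY_rel3_stmt → ldY_swap12_stmt → ldSE_rowSource_stmt`                (`ldSE_rowSource_of_descent`),

hence `→ levelDescentVFull` (`levelDescentVFull_of_descent`), to two identities that involve ONLY the boundary sum `SE`
(the dual coefficient `U` is eliminated from the open part):
* `ldY_rel3_stmt` (REL-3): `Y` satisfies the `η`-cleared slot-1 face relation
  `d·Y(b+2e₁) + Γ₁·r₂·Y(b+e₁) + Γ₀·r₁r₂·Y(b) = 0`, `r₁ = (b₁+1)(N−b₁)`, `r₂ = (b₁+2)(N−b₁−1)`, `Γᵢ = faceGammaᵢ b 0`,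
  on the rows with `c₁₂ = N − b₁ − b₂ ≥ 1`;
* `ldY_swap12_stmt`: `Y(b⁽¹²⁾)·η(b−e₂) = η(b⁽¹²⁾−e₂)·Y(b)`, `b⁽¹²⁾` = `b` with the slots 1 and 2 exchanged (`swap12`).
Both are certified EXACTLY outside Lean and are conjecture-tagged HERE (internally minted, not literature): REL-3 by the engine
certificate `eng-exactrec-1 / zeta5ct-0.1` (MANIFEST e8bc5dda0b45603e: a WZ pair for the kernel sums `K_μ = ldKer b μ` giving a
second-order recurrence in `μ`, and a termwise telescoping certificate; engine check termwise 236/236, this cell 60/60 rows of the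
`η`-cleared form incl. 24 rows with `c₁₂ = 1`), the swap identity termwise in `μ` (86/86) and summed (25/25) (gen-1 g9, `e4_cross12.py`,
`e5_rel3Y.py`). Their Lean proofs are the next staged files (`…VFullRecK`, `…VFullKModule`, `…VFullRel3`).

MECHANISM (why `U` drops out). `U` satisfies the slot-1 three-term face relation `d·U(b+2e₁) + Γ₁U(b+e₁) + Γ₀U(b) = 0` on the
wide row region (`face_threeTerm` + `coeff_rel_of_summable`, exactly as in `casUV_rowSource`; `coeffU_faceRel_slot1`), and
`η(a+e₁) = (a₁+1)(N−a₁)·η(a)` (`rowEta_bump1`); hence `T` satisfies the same `η`-cleared relation as `Y` (`ldT_step`). DESCENT on the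
layer index `c₁₂ ≥ 1`: `Γ₀ = c₁₂·∏_{k∈B}(N−b₁−b_k)` (`faceGamma0_slot1`), so when `Γ₀ ≠ 0`, `T(b)` is determined by `T(b+e₁)` (layer
`c₁₂−1`) and `T(b+2e₁)` (layer `c₁₂−2`). BASES: layer `0` is the tree theorem `ldSE_rowSource_layer0_holds`; on layer `−1`
(`b₁ + b₂ = N + 1`) all of `SE(b)`, `SE(b−e₂)` (clean shapes, `ldSE_eq_zero_of_clean`) and `U(b)` vanish — the latter because `numPoly b`
has a DOUBLE root at every `−q`, `0 ≤ q ≤ N` (`sq_dvd_numPoly_of_layer_neg1`, `coeffU_eq_zero_of_layer_neg1`, via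
`LevelDescent.coeffU_eq_sum_top`). When `Γ₀ = 0` (then `b₁ = N − b_k ≥ N/2` for some `k ∈ B`, so `Γ₀(b⁽¹²⁾) ≠ 0`), the swap identity
and the slot symmetry of `U` (`coeffU_swap`) transport `T(b⁽¹²⁾) = 0` to `T(b) = 0` (`ldT_descent`).
-/

open Finset Polynomial

namespace Summit.KontsevichZagierPeriods.Zeta5Search.WedgeDictionary

open Summit.KontsevichZagierPeriods.Zeta5Search.DualSeries
open Literature.NumberTheory.Transcendental
open Literature.NumberTheory.Transcendental.BallRivoal (pochPoly eval_pochPoly poch)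

/-! ### §1 The objects `Y`, `T`, `swap12` and the two hypotheses -/

/-- `Y(b) := (d+1)·SE(b) − Π₂(b)·SE(b − e₂)` — the boundary-sum side of (T3). -/
noncomputable def ldY (b : ℕ → ℤ) : ℚ := ((dOf b : ℚ) + 1) * ldSE b - mixedPi2 b * ldSE (lowerSlot b 2)

/-- `T(b) := Y(b) − η(b − e₂)·U(b)`; (T3) at the row `b` says precisely `T(b) = 0`. -/
noncomputable def ldT (b : ℕ → ℤ) : ℚ := ldY b - rowEta (lowerSlot b 2) * coeffU b

/-- `b⁽¹²⁾`: the shape `b` with the slots `1` and `2` exchanged. -/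
def swap12 (b : ℕ → ℤ) : ℕ → ℤ := fun i => b (Equiv.swap 1 2 i)

/-- **REL-3 — PROVED** (`ldY_rel3_holds`, `WedgeDictionaryLevelDescentVFullRel3`, p227810; proof chain p225120 KernelRatio, p225899 RecKInterior,
p226627 RecK (REC-K, WZ certificate), p226306 KModule, p226976 CwRatio, p227507 Rel3Cert (creative-telescoping certificate); internally minted, first
certified exactly by the engine certificate `eng-exactrec-1 / zeta5ct-0.1` and 60/60 rows in this cell; the `@[conjecture]` tag is kept only as the
obligation-node marker): on the rows with `c₁₂ ≥ 1`, `Y` satisfies the `η`-cleared slot-1 face relation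
`d·Y(b+2e₁) + Γ₁·(b₁+2)(N−b₁−1)·Y(b+e₁) + Γ₀·(b₁+1)(N−b₁)(b₁+2)(N−b₁−1)·Y(b) = 0`. -/
@[conjecture] def ldY_rel3_stmt : Prop :=
  ∀ b : ℕ → ℤ, 0 ≤ b 0 → (∀ j ∈ Icc 1 7, 0 ≤ b j ∧ b j ≤ b 0) → (∀ j ∈ Icc 3 6, 2 * b j ≤ b 0) → 0 ≤ dOf b →
    1 ≤ b 2 → b 7 = 0 → b 1 + b 2 + 1 ≤ b 0 →
    (dOf b : ℚ) * ldY (bump (bump b 0) 0) +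
        faceGamma1 b 0 * (((b 1 : ℚ) + 2) * ((b 0 : ℚ) - b 1 - 1)) * ldY (bump b 0) +
      faceGamma0 b 0 * ((((b 1 : ℚ) + 1) * ((b 0 : ℚ) - b 1)) * (((b 1 : ℚ) + 2) * ((b 0 : ℚ) - b 1 - 1))) * ldY b = 0

/-- HYPOTHESIS (slot exchange; internally minted, exact check 25/25 summed and 86/86 termwise in this cell; it is the `(1,2)` analogue of the
proved `(2,7)` cross relation `ldE_cross`, and in the `K`-module form of `Y` it is the `b₁ ↔ b₂` symmetry of the carrier weights):
`Y(b⁽¹²⁾)·η(b − e₂) = η(b⁽¹²⁾ − e₂)·Y(b)` on the rows with `b₁, b₂ ≥ 1`, `c₁₂ ≥ 1`. -/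
@[conjecture] def ldY_swap12_stmt : Prop :=
  ∀ b : ℕ → ℤ, 0 ≤ b 0 → (∀ j ∈ Icc 1 7, 0 ≤ b j ∧ b j ≤ b 0) → (∀ j ∈ Icc 3 6, 2 * b j ≤ b 0) → 0 ≤ dOf b →
    1 ≤ b 1 → 1 ≤ b 2 → b 7 = 0 → b 1 + b 2 + 1 ≤ b 0 →
    ldY (swap12 b) * rowEta (lowerSlot b 2) = rowEta (lowerSlot (swap12 b) 2) * ldY b

/-! ### §2 Evaluation lemmas (slot exchange, `b + e₁`, `Γ₀`, the layer index, `η`) -/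

/-- Values of `b⁽¹²⁾`. -/
theorem swap12_apply (b : ℕ → ℤ) (i : ℕ) : swap12 b i = if i = 1 then b 2 else if i = 2 then b 1 else b i := by
  simp only [swap12, Equiv.swap_apply_def]
  split_ifs <;> rfl

/-- `b⁽¹²⁾₀ = b₀`. -/
theorem swap12_zero (b : ℕ → ℤ) : swap12 b 0 = b 0 := by simp [swap12_apply]

/-- `b⁽¹²⁾` agrees with `b` off the slots `1, 2`. -/
theorem swap12_of_ne (b : ℕ → ℤ) {i : ℕ} (h1 : i ≠ 1) (h2 : i ≠ 2) : swap12 b i = b i := by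
  simp [swap12_apply, h1, h2]

/-- `d(b⁽¹²⁾) = d(b)`. -/
theorem dOf_swap12 (b : ℕ → ℤ) : dOf (swap12 b) = dOf b :=
  dOf_swap b (show 1 ∈ ({1, 2, 7} : Finset ℕ) by simp) (show 2 ∈ ({1, 2, 7} : Finset ℕ) by simp)

/-- `U(b⁽¹²⁾) = U(b)` (tree: `coeffU_swap`). -/
theorem coeffU_swap12 (b : ℕ → ℤ) : coeffU (swap12 b) = coeffU b :=
  coeffU_swap b (show 1 ∈ Icc 1 7 by simp) (show 2 ∈ Icc 1 7 by simp)

/-- Values of `b + e₁`. -/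
theorem bump0_apply (b : ℕ → ℤ) (i : ℕ) : bump b 0 i = if i = 1 then b 1 + 1 else b i := by
  simp only [bump, Nat.zero_add, Function.update_apply]

/-- `(b + e₁)₁ = b₁ + 1`. -/
theorem bump0_one (b : ℕ → ℤ) : bump b 0 1 = b 1 + 1 := by rw [bump0_apply, if_pos rfl]

/-- `(b + e₁)ᵢ = bᵢ` for `i ≠ 1`. -/
theorem bump0_of_ne (b : ℕ → ℤ) {i : ℕ} (h : i ≠ 1) : bump b 0 i = b i := by rw [bump0_apply, if_neg h]

/-- `Γ₀` in direction `1`, expanded: `Γ₀(b,0) = (N−b₁−b₂)·∏_{k∈B}(N−b₁−b_k)`. -/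
theorem faceGamma0_slot1 (b : ℕ → ℤ) : faceGamma0 b 0 =
    ((b 0 : ℚ) - b 1 - b 2) * (((b 0 : ℚ) - b 1 - b 3) * (((b 0 : ℚ) - b 1 - b 4) *
      (((b 0 : ℚ) - b 1 - b 5) * ((b 0 : ℚ) - b 1 - b 6)))) := by
  simp [faceGamma0, prod_range_succ]
  ring

/-- The layer index is at most `d`: `N − b₁ − b₂ ≤ d(b)` when the `B`-slots lie in the half box and `b₇ = 0`. -/
theorem layer_le_dOf (b : ℕ → ℤ) (hB : ∀ j ∈ Icc 3 6, 2 * b j ≤ b 0) (hb7 : b 7 = 0) : b 0 - b 1 - b 2 ≤ dOf b := by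
  have h3 := hB 3 (by simp); have h4 := hB 4 (by simp); have h5 := hB 5 (by simp); have h6 := hB 6 (by simp)
  unfold dOf
  simp only [sum_range_succ, sum_range_zero, Nat.reduceAdd]
  omega

/-- From the `Icc 1 7` box hypothesis to `InBox` and `b_j ≤ N`. -/
theorem inBox_of_rowBox (b : ℕ → ℤ) (h0 : 0 ≤ b 0) (hbox : ∀ j ∈ Icc 1 7, 0 ≤ b j ∧ b j ≤ b 0) :
    InBox b ∧ ∀ j ∈ range 7, b (j + 1) ≤ b 0 := by
  refine ⟨⟨h0, fun j hj => ?_⟩, fun j hj => ?_⟩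
  · have := hbox (j + 1) (by simp only [mem_range] at hj; simp only [mem_Icc]; omega); omega
  · exact (hbox (j + 1) (by simp only [mem_range] at hj; simp only [mem_Icc]; omega)).2

/-- `η(a) ≠ 0` for `a` in the box with `a_j ≤ N` (from `rowEta_fac`). -/
theorem rowEta_ne_zero (a : ℕ → ℤ) (ha : InBox a) (hle : ∀ j ∈ range 7, a (j + 1) ≤ a 0) : rowEta a ≠ 0 := by
  intro h
  have hf := rowEta_fac a ha hle
  rw [h, zero_mul] at hf
  exact (mul_ne_zero (prod_ne_zero_iff.2 fun j _ => facQ_ne_zero _) (facQ_ne_zero _)) hf.symm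

/-- `(b + e₁) − e₂ = (b − e₂) + e₁`. -/
theorem lowerSlot2_bump0 (b : ℕ → ℤ) :
    lowerSlot (bump b 0) 2 = Function.update (lowerSlot b 2) 1 (lowerSlot b 2 1 + 1) := by
  funext i
  simp only [lowerSlot, bump, Nat.zero_add, Function.update_apply]
  split_ifs <;> first | rfl | omega

/-- `η((b + e₁) − e₂) = (b₁+1)(N−b₁)·η(b − e₂)` on rows with `b₂ ≥ 1`, `b₁ + 1 ≤ N`. -/
theorem rowEta_lowerSlot2_bump0 (b : ℕ → ℤ) (h0 : 0 ≤ b 0) (hbox : ∀ j ∈ Icc 1 7, 0 ≤ b j ∧ b j ≤ b 0)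
    (hb2 : 1 ≤ b 2) (h1 : b 1 + 1 ≤ b 0) :
    rowEta (lowerSlot (bump b 0) 2) = ((b 1 : ℚ) + 1) * ((b 0 : ℚ) - b 1) * rowEta (lowerSlot b 2) := by
  have hIn : InBox (lowerSlot b 2) := by
    rw [inBox_iff]
    simp only [lowerSlot2_apply, mem_Icc] at hbox ⊢
    have := hbox 1; have := hbox 2; have := hbox 3; have := hbox 4; have := hbox 5; have := hbox 6; have := hbox 7
    norm_num
    omega
  have hle : ∀ j ∈ range 7, lowerSlot b 2 (j + 1) ≤ lowerSlot b 2 0 := by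
    intro j hj
    simp only [mem_range] at hj
    have := hbox (j + 1) (by simp only [mem_Icc]; omega)
    rw [lowerSlot2_apply, lowerSlot2_apply, if_neg (show (0 : ℕ) ≠ 2 by decide)]
    split_ifs with h
    · rw [h] at this; omega
    · exact this.2
  rw [lowerSlot2_bump0, rowEta_bump1 _ hIn hle (by simp only [lowerSlot2_apply]; norm_num; omega)]
  simp only [lowerSlot2_apply]
  norm_num

/-! ### §3 The descent -/

/-- ONE STEP: on a row `b` with `c₁₂ ≥ 1` and `Γ₀(b,0) ≠ 0`, REL-3 for `Y`, the face relation for `U` and the `η`-ratio give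
`T(b) = 0` from `T(b+e₁) = 0` and `T(b+2e₁) = 0`. -/
theorem ldT_step (hR : ldY_rel3_stmt) (b : ℕ → ℤ) (h0 : 0 ≤ b 0) (hbox : ∀ j ∈ Icc 1 7, 0 ≤ b j ∧ b j ≤ b 0)
    (hB : ∀ j ∈ Icc 3 6, 2 * b j ≤ b 0) (hd : 0 ≤ dOf b) (hb2 : 1 ≤ b 2) (hb7 : b 7 = 0) (hc : b 1 + b 2 + 1 ≤ b 0)
    (hΓ : faceGamma0 b 0 ≠ 0) (hT1 : ldT (bump b 0) = 0) (hT2 : ldT (bump (bump b 0) 0) = 0) : ldT b = 0 := by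
  obtain ⟨hIn, hle⟩ := inBox_of_rowBox b h0 hbox
  have hb1 : 0 ≤ b 1 := (hbox 1 (by simp)).1
  have hd1 : 1 ≤ dOf b := by have := layer_le_dOf b hB hb7; omega
  have hY := hR b h0 hbox hB hd hb2 hb7 hc
  have hU := coeffU_faceRel_slot1 b hIn hle hb7 hd1 (by omega)
  -- the η-ratios along the slot-1 string
  have hη1 := rowEta_lowerSlot2_bump0 b h0 hbox hb2 (by omega)
  have hbox1 : ∀ j ∈ Icc 1 7, 0 ≤ bump b 0 j ∧ bump b 0 j ≤ bump b 0 0 := by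
    intro j hj
    rw [bump_zero]
    by_cases h : j = 1
    · subst h; rw [bump0_one]; constructor <;> omega
    · rw [bump0_of_ne b h]; exact hbox j hj
  have hη2 := rowEta_lowerSlot2_bump0 (bump b 0) (by rw [bump_zero]; exact h0) hbox1
    (by rw [bump0_of_ne b (by decide)]; exact hb2) (by rw [bump0_one, bump_zero]; omega)
  rw [hη1, bump0_one, bump_zero] at hη2
  push_cast at hη2
  unfold ldT at hT1 hT2 ⊢
  rw [hη1] at hT1
  rw [hη2] at hT2
  have hr1 : (0 : ℚ) < ((b 1 : ℚ) + 1) * ((b 0 : ℚ) - b 1) := by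
    have : (0 : ℤ) < (b 1 + 1) * (b 0 - b 1) := mul_pos (by omega) (by omega)
    exact_mod_cast this
  have hr2 : (0 : ℚ) < ((b 1 : ℚ) + 2) * ((b 0 : ℚ) - b 1 - 1) := by
    have : (0 : ℤ) < (b 1 + 2) * (b 0 - b 1 - 1) := mul_pos (by omega) (by omega)
    exact_mod_cast this
  have hne : faceGamma0 b 0 * ((((b 1 : ℚ) + 1) * ((b 0 : ℚ) - b 1)) * (((b 1 : ℚ) + 2) * ((b 0 : ℚ) - b 1 - 1))) ≠ 0 :=
    mul_ne_zero hΓ (mul_pos hr1 hr2).ne'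
  have key : faceGamma0 b 0 * ((((b 1 : ℚ) + 1) * ((b 0 : ℚ) - b 1)) * (((b 1 : ℚ) + 2) * ((b 0 : ℚ) - b 1 - 1))) *
      (ldY b - rowEta (lowerSlot b 2) * coeffU b) = 0 := by
    linear_combination hY - (rowEta (lowerSlot b 2) * ((((b 1 : ℚ) + 1) * ((b 0 : ℚ) - b 1)) *
      (((b 1 : ℚ) + 2) * ((b 0 : ℚ) - b 1 - 1)))) * hU - (dOf b : ℚ) * hT2 -
      (faceGamma1 b 0 * (((b 1 : ℚ) + 2) * ((b 0 : ℚ) - b 1 - 1))) * hT1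
  exact (mul_eq_zero.1 key).resolve_left hne

/-- BASE, layer `−1`: on a shape with `b₇ = 0`, `b₁ + b₂ = N + 1` (in the box, `b_j ≤ N`, `Σ b_j ≤ 3N+1`) all three of `SE(b)`, `SE(b − e₂)`,
`U(b)` vanish, hence `T(b) = 0`. -/
theorem ldT_layer_neg1 (b : ℕ → ℤ) (hIn : InBox b) (hsum : ∑ j ∈ range 7, b (j + 1) ≤ 3 * b 0 + 1) (hb7 : b 7 = 0)
    (h12 : b 1 + b 2 = b 0 + 1) : ldT b = 0 := by
  unfold ldT ldY
  rw [ldSE_eq_zero_of_clean b (by unfold sigmaT; omega),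
    ldSE_eq_zero_of_clean (lowerSlot b 2) (by unfold sigmaT; simp only [lowerSlot2_apply]; norm_num; omega),
    coeffU_eq_zero_of_layer_neg1 b hIn hsum h12]
  ring

/-- **THE DESCENT.** Under REL-3 and the swap identity, `T(b) = 0` on every row of (T3), by strong induction on the layer
`n = N − b₁ − b₂`: layer `0` is `ldSE_rowSource_layer0_holds`; on layer `n + 1`, a row with `Γ₀ ≠ 0` descends to the layers `n` and
`n − 1` (`ldT_step`; layer `−1` is `ldT_layer_neg1`), and a row with `Γ₀ = 0` has `b₁ = N − b_k` for some `k ∈ B`, so its slot exchange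
`b⁽¹²⁾` has `Γ₀ ≠ 0` and the swap identity with `coeffU_swap` transports `T(b⁽¹²⁾) = 0` back. -/
theorem ldT_descent (hR : ldY_rel3_stmt) (hS : ldY_swap12_stmt) (n : ℕ) :
    ∀ b : ℕ → ℤ, 0 ≤ b 0 → (∀ j ∈ Icc 1 7, 0 ≤ b j ∧ b j ≤ b 0) → (∀ j ∈ Icc 3 6, 2 * b j ≤ b 0) → 0 ≤ dOf b →
      1 ≤ b 2 → b 7 = 0 → b 1 + b 2 + n = b 0 → ldT b = 0 := by
  induction n using Nat.strong_induction_on with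
  | h n ih =>
  intro b h0 hbox hB hd hb2 hb7 hn
  rcases n with _ | n
  · have h := ldSE_rowSource_layer0_holds b h0 hbox hB hd hb2 hb7 (by push_cast at hn; omega)
    unfold ldT ldY
    linear_combination h
  -- rows of layer `n + 1` with `Γ₀ ≠ 0`
  have step : ∀ a : ℕ → ℤ, 0 ≤ a 0 → (∀ j ∈ Icc 1 7, 0 ≤ a j ∧ a j ≤ a 0) → (∀ j ∈ Icc 3 6, 2 * a j ≤ a 0) →
      0 ≤ dOf a → 1 ≤ a 2 → a 7 = 0 → a 1 + a 2 + (n + 1) = a 0 → faceGamma0 a 0 ≠ 0 → ldT a = 0 := by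
    intro a h0 hbox hB hd hb2 hb7 hn hΓ
    obtain ⟨hIn, hle⟩ := inBox_of_rowBox a h0 hbox
    have hb1 : 0 ≤ a 1 := (hbox 1 (by simp)).1
    have hd1 : (n : ℤ) + 1 ≤ dOf a := by have := layer_le_dOf a hB hb7; omega
    have hbox1 : ∀ j ∈ Icc 1 7, 0 ≤ bump a 0 j ∧ bump a 0 j ≤ bump a 0 0 := by
      intro j hj
      rw [bump_zero]
      by_cases h : j = 1
      · subst h; rw [bump0_one]; constructor <;> omega
      · rw [bump0_of_ne a h]; exact hbox j hj
    have hB1 : ∀ j ∈ Icc 3 6, 2 * bump a 0 j ≤ bump a 0 0 := by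
      intro j hj
      rw [bump_zero, bump0_of_ne a (by simp only [mem_Icc] at hj; omega)]
      exact hB j hj
    have hT1 : ldT (bump a 0) = 0 :=
      ih n (by omega) (bump a 0) (by rw [bump_zero]; exact h0) hbox1 hB1 (by rw [dOf_bump a (by simp)]; omega)
        (by rw [bump0_of_ne a (by decide)]; exact hb2) (by rw [bump0_of_ne a (by decide)]; exact hb7)
        (by rw [bump0_one, bump0_of_ne a (by decide), bump_zero]; omega)
    have hT2 : ldT (bump (bump a 0) 0) = 0 := by
      rcases n with _ | m
      · obtain ⟨hIn1, -⟩ := box_update a hIn hd (show 0 ∈ range 7 by simp) (hle 0 (by simp))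
        obtain ⟨hIn2, hs2⟩ := box_update (bump a 0) hIn1 (by rw [dOf_bump a (by simp)]; omega) (show 0 ∈ range 7 by simp)
          (by show bump a 0 1 ≤ bump a 0 0; rw [bump0_one, bump_zero]; push_cast at hn; omega)
        exact ldT_layer_neg1 _ hIn2 hs2 (by rw [bump0_of_ne _ (by decide), bump0_of_ne a (by decide)]; exact hb7)
          (by rw [bump0_one, bump0_one, bump0_of_ne _ (by decide), bump0_of_ne a (by decide), bump_zero, bump_zero]
              push_cast at hn ⊢; omega)
      · have hbox2 : ∀ j ∈ Icc 1 7, 0 ≤ bump (bump a 0) 0 j ∧ bump (bump a 0) 0 j ≤ bump (bump a 0) 0 0 := by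
          intro j hj
          rw [bump_zero, bump_zero]
          by_cases h : j = 1
          · subst h; rw [bump0_one, bump0_one]; push_cast at hn; constructor <;> omega
          · rw [bump0_of_ne _ h, bump0_of_ne a h]; exact hbox j hj
        have hB2 : ∀ j ∈ Icc 3 6, 2 * bump (bump a 0) 0 j ≤ bump (bump a 0) 0 0 := by
          intro j hj
          have hj1 : j ≠ 1 := by simp only [mem_Icc] at hj; omega
          rw [bump_zero, bump_zero, bump0_of_ne _ hj1, bump0_of_ne a hj1]
          exact hB j hj
        exact ih m (by omega) (bump (bump a 0) 0) (by rw [bump_zero, bump_zero]; exact h0) hbox2 hB2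
          (by rw [dOf_bump _ (by simp), dOf_bump a (by simp)]; push_cast at hd1 ⊢; omega)
          (by rw [bump0_of_ne _ (by decide), bump0_of_ne a (by decide)]; exact hb2)
          (by rw [bump0_of_ne _ (by decide), bump0_of_ne a (by decide)]; exact hb7)
          (by rw [bump0_one, bump0_one, bump0_of_ne _ (by decide), bump0_of_ne a (by decide), bump_zero, bump_zero]
              push_cast at hn ⊢; omega)
    exact ldT_step hR a h0 hbox hB hd hb2 hb7 (by omega) hΓ hT1 hT2
  by_cases hΓ : faceGamma0 b 0 ≠ 0
  · exact step b h0 hbox hB hd hb2 hb7 hn hΓ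
  -- `Γ₀(b) = 0`: exchange the slots 1 and 2
  rw [not_ne_iff, faceGamma0_slot1] at hΓ
  have h3 := hB 3 (by simp); have h4 := hB 4 (by simp); have h5 := hB 5 (by simp); have h6 := hB 6 (by simp)
  have hk : 2 * b 1 ≥ b 0 := by
    rcases mul_eq_zero.1 hΓ with h | h
    · have : (b 0 - b 1 - b 2 : ℤ) = 0 := by exact_mod_cast h
      push_cast at hn; omega
    rcases mul_eq_zero.1 h with h | h
    · have : (b 0 - b 1 - b 3 : ℤ) = 0 := by exact_mod_cast h
      omega
    rcases mul_eq_zero.1 h with h | h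
    · have : (b 0 - b 1 - b 4 : ℤ) = 0 := by exact_mod_cast h
      omega
    rcases mul_eq_zero.1 h with h | h
    · have : (b 0 - b 1 - b 5 : ℤ) = 0 := by exact_mod_cast h
      omega
    · have : (b 0 - b 1 - b 6 : ℤ) = 0 := by exact_mod_cast h
      omega
  have hb1 : 1 ≤ b 1 := by push_cast at hn; omega
  have h0' : 0 ≤ swap12 b 0 := by rw [swap12_zero]; exact h0
  have hbox' : ∀ j ∈ Icc 1 7, 0 ≤ swap12 b j ∧ swap12 b j ≤ swap12 b 0 := by
    intro j hj
    rw [swap12_zero, swap12_apply]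
    split_ifs
    · exact hbox 2 (by simp)
    · exact hbox 1 (by simp)
    · exact hbox j hj
  have hB' : ∀ j ∈ Icc 3 6, 2 * swap12 b j ≤ swap12 b 0 := by
    intro j hj
    simp only [mem_Icc] at hj
    rw [swap12_zero, swap12_of_ne b (by omega) (by omega)]
    exact hB j (by simp only [mem_Icc]; omega)
  have hd' : 0 ≤ dOf (swap12 b) := by rw [dOf_swap12]; exact hd
  have hΓ' : faceGamma0 (swap12 b) 0 ≠ 0 := by
    rw [faceGamma0_slot1, swap12_zero, swap12_apply, swap12_apply, swap12_of_ne b (by decide) (by decide),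
      swap12_of_ne b (by decide) (by decide), swap12_of_ne b (by decide) (by decide), swap12_of_ne b (by decide) (by decide)]
    simp only [if_true, if_false, Nat.reduceEqDiff]
    have i2 : (0 : ℚ) < (b 0 : ℚ) - b 2 - b 1 := by
      have : (0 : ℤ) < b 0 - b 2 - b 1 := by push_cast at hn; omega
      exact_mod_cast this
    have i3 : (0 : ℚ) < (b 0 : ℚ) - b 2 - b 3 := by
      have : (0 : ℤ) < b 0 - b 2 - b 3 := by push_cast at hn; omega
      exact_mod_cast this
    have i4 : (0 : ℚ) < (b 0 : ℚ) - b 2 - b 4 := by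
      have : (0 : ℤ) < b 0 - b 2 - b 4 := by push_cast at hn; omega
      exact_mod_cast this
    have i5 : (0 : ℚ) < (b 0 : ℚ) - b 2 - b 5 := by
      have : (0 : ℤ) < b 0 - b 2 - b 5 := by push_cast at hn; omega
      exact_mod_cast this
    have i6 : (0 : ℚ) < (b 0 : ℚ) - b 2 - b 6 := by
      have : (0 : ℤ) < b 0 - b 2 - b 6 := by push_cast at hn; omega
      exact_mod_cast this
    exact mul_ne_zero i2.ne' (mul_ne_zero i3.ne' (mul_ne_zero i4.ne' (mul_ne_zero i5.ne' i6.ne')))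
  have hT' := step (swap12 b) h0' hbox' hB' hd' (by rw [swap12_apply]; simpa using hb1)
    (by rw [swap12_of_ne b (by decide) (by decide)]; exact hb7)
    (by rw [swap12_apply, swap12_apply, swap12_zero]; simpa [add_comm] using hn) hΓ'
  have hsw := hS b h0 hbox hB hd hb1 hb2 hb7 (by push_cast at hn; omega)
  -- `η(b⁽¹²⁾ − e₂) ≠ 0`
  obtain ⟨hIn', hle'⟩ := inBox_of_rowBox (swap12 b) h0' hbox'
  have hInL : InBox (lowerSlot (swap12 b) 2) := by
    rw [inBox_iff]
    simp only [lowerSlot2_apply, mem_Icc] at hbox' ⊢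
    have := hbox' 1; have := hbox' 2; have := hbox' 3; have := hbox' 4; have := hbox' 5; have := hbox' 6; have := hbox' 7
    have e2 : swap12 b 2 = b 1 := by simp [swap12_apply]
    norm_num
    omega
  have hleL : ∀ j ∈ range 7, lowerSlot (swap12 b) 2 (j + 1) ≤ lowerSlot (swap12 b) 2 0 := by
    intro j hj
    simp only [mem_range] at hj
    have := hbox' (j + 1) (by simp only [mem_Icc]; omega)
    rw [lowerSlot2_apply, lowerSlot2_apply, if_neg (show (0 : ℕ) ≠ 2 by decide)]
    split_ifs with h
    · rw [h] at this; omega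
    · exact this.2
  have hη : rowEta (lowerSlot (swap12 b) 2) ≠ 0 := rowEta_ne_zero _ hInL hleL
  unfold ldT at hT' ⊢
  rw [coeffU_swap12] at hT'
  have key : rowEta (lowerSlot (swap12 b) 2) * (ldY b - rowEta (lowerSlot b 2) * coeffU b) = 0 := by
    linear_combination (-1 : ℚ) * hsw + rowEta (lowerSlot b 2) * hT'
  exact (mul_eq_zero.1 key).resolve_left hη

/-! ### §4 The reduction of (T3), and of `levelDescentVFull` -/

/-- **REDUCTION (kernel-checked).** REL-3 for `Y` and the slot-exchange identity imply (T3) `ldSE_rowSource_stmt` on ALL its rows. -/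
theorem ldSE_rowSource_of_descent (hR : ldY_rel3_stmt) (hS : ldY_swap12_stmt) : ldSE_rowSource_stmt := by
  intro b h0 hbox hB hd hb2 hb7 h12
  have hT := ldT_descent hR hS (b 0 - b 1 - b 2).toNat b h0 hbox hB hd hb2 hb7 (by omega)
  unfold ldT ldY at hT
  linear_combination hT

/-- Hence `levelDescentVFull` (the corrected constant row `casUV + SE = ldSum V` on the whole unclean box) follows from the two
`SE`-only identities (`levelDescentVFull_reduction_holds`). -/
theorem levelDescentVFull_of_descent (hR : ldY_rel3_stmt) (hS : ldY_swap12_stmt) : levelDescentVFull :=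
  levelDescentVFull_reduction_holds (ldSE_rowSource_of_descent hR hS)

end Summit.KontsevichZagierPeriods.Zeta5Search.WedgeDictionary
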